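import Literature.Claims.NS.Chae2007
import Literature.Claims.NS.ClayR3EnstrophyBridge
import Literature.Analysis.FluidPDE.VorticityCalculus
import Literature.Analysis.FluidPDE.BKMClassVorticityTimeLipschitz
import HarnessLib

/-!
# Claim skeleton C137 — Bruno Luçardo Olivaes, «Analytical Proof of Finite-Time Blow-Up in the 3D
# Incompressible Navier-Stokes Equations via Topological Self-Compression» (Zenodo, 2026-08-06, 3 pp.)

Cell `ns-claims` (D-0090 NS-CLAIMS SWEEP), claim **C137** (T3 QUICK, NEG / Clay-(C) direction; RULINGS
v1.31j (1)), typist `ns-claims-typist-10` g4 (lanes: sources lit-2 g4 `pub/ns-claims/sources/LucardoOlivaes2026/`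
with LOCATORS.md; refuter refuter-2 g4; referee ref-1 g4; filer/salvage salvage-p4 g3; writer-1).
UNREFEREED CLAIM under adjudication — NOTHING in this file asserts a step: every printed assertion is a
`def … : Prop`; the only `theorem`s are the kernel composition of the paper's own implications and plumbing.

Text of record: Zenodo record 21815761 `Navier_Stokes_Ouroboros_Unforced.pdf` (= v2, 2026-08-06, of concept
10.5281/zenodo.21516921; byte-identical to record 21815724 = v2 of concept 10.5281/zenodo.21694126), md5
2e80b1042dfc88a77f90d97f51274c2f, 3 pp., English, PDF page = printed page, `pages/p00N.txt` line numbers `l.`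
[LucardoOlivaes2026]. Versions (LOCATORS §0): the v1 files of both concepts are DIFFERENT texts — a FORCED
blow-up claim (acoustic force `F_a`, 2026-07-29) and numerical «evidence for global regularity» of a restricted
model (2026-07-23); the typed text is the unforced v2. No theorem environment: the claim sentence is the
abstract (p.1 l.8–18) with §6 (p.3 l.1–22).

## Claimed statement (as printed)

Abstract p.1 l.10–16: «we demonstrate an analytical proof of finite-time blow-up by constructing a highly
specific topological initial condition, devoid of any external forcing (F ≡ 0). By mapping the initial velocity
field to a Modulo-9 Ouroboros topological knot (anti-parallel vortex rings), we prove that the non-linear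
convective term (u·∇)u inherently generates an extreme radial compression node. We rigorously demonstrate that
this self-induced vortex stretching strictly dominates viscous dissipation in a compact topological
neighborhood, leading to a singularity where enstrophy diverges in finite time.» §6 p.3 l.12–15: «The solution
to this differential equation diverges to infinity in finite time T*.» Setting §2 p.1 l.31–45: `ℝ³`, (1)–(2)
unforced, `ν > 0`, `u₀ ∈ H^m(ℝ³)`, `m ≥ 3`. Typed: `ClaimedTheorem` — for every `ν > 0` there is a datum of
the printed class (the «Ouroboros» datum: §3 prints NO formula — only prose: «the initial vorticity field ω₀
is localized in two anti-parallel vortex rings colliding at the plane z = 0», p.2 l.13–14 — so the datum is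
typed as the CLASS `IsOuroDatum` of its printed analytic content: smooth with every derivative in `L²`
(«`H^m`, `m ≥ 3`, guaranteeing initial smoothness»), divergence free, vorticity compactly supported
(«localized») and not identically zero; the geometric words (Modulo-9 knot, `u_r < 0` near the node, the
alignment of `ω` with the top eigenvector of `S`) carry no formula and are not typed) whose regular solution
has ENSTROPHY DIVERGING at a finite time (`EnstrophyDiverges`). Every Step below quantifies over all data of
the class (FAILURE-MODES F17 reconstruction; the referee judges faithfulness of any instance used).

## Clay delta (reference `ClayVariants.lean`, Δ-axes §3; facts LOCATORS §5)

Nearest: (C) `NavierStokesBreakdownR3`. Δ1 `ℝ³` = · Δ2 `ν > 0` = · Δ3 `F ≡ 0` = (the v1 texts were forced: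
versions cell) · **Δ4 DATA `u₀ ∈ H^m`, `m ≥ 3` ≠ Clay (4)** (no rapid-decay clause; a vortex-ring datum's
velocity decays only algebraically in general) · Δ5 solution class «regular solution»/BKM (typed: the cell's
BKM class `Chae2007.IsLocalSolution`) · Δ6 conclusion «enstrophy diverges in finite time» for ONE datum —
(C)-shaped. `clay_of_divergence` (PROVED): an enstrophy divergence along a regular solution from an Ouroboros
datum THAT IS ALSO of class (4) is a (C)-certificate (tree `navierStokesBreakdownR3_of_enstrophyBlowupCertificate`
+ the energy inequality `bkm_energy_le`); `clay_of_claimed` verbatim is NOT provable (Δ4) — recorded, not a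
wrong-problem call by the typist.

## Step table (print order; typist's private flags live in the CARD; nothing asserted)

* (3) `Step4_VorticityEq` · p.2 l.1–4 · vorticity equation — true (classical), recorded.
* (4) BKM · p.2 l.5–11 · «blows up at T* iff ∫₀^{T*}‖ω‖_∞ = ∞» — a THEOREM of the tree in this class
  (`Literature.Analysis.FluidPDE.beale_kato_majda_holds`, C17 `Chae2007.Step_2`); cited by name, no Step fact
  (lit-4 g5 rule); its use p.3 l.18–19 is `Step11_BKM`.
* §3 `Step3_Datum` · p.2 l.12–26 · the construction, at the grain of its printed analytic content: an
  Ouroboros-class datum EXISTS — true (any smooth compactly supported divergence-free field with non-zero curl).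
* (5) `Step5_EnstrophyId` · p.2 l.27–43 · `½ d/dt‖ω‖² = ∫ω·(ω·∇)u − ν‖∇ω‖²` — true (classical).
* **(6) `Step6_StretchLower` · §4.1 p.2 l.44–54 · «∫_{ℝ³} ω·(ω·∇)u dV ≥ C₁‖ω‖_{L^∞}‖ω‖²_{L²}» along the
  solution, `C₁ > 0` a constant of the datum, every `t ∈ [0,T*)` — census/CARD-PREDICTED LOCATOR** (no
  derivation printed; at `t = 0` it asserts `∫ω₀·(ω₀·∇)u₀ > 0` for every datum of the class). Functions face
  `Step6F_StretchLower_fun` alongside (kernel handle; not consumed).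
* §5 `Step7_DissipRate` · p.2 l.56–66 · «the viscous term grows at a thermodynamic rate O(‖ω‖^{4/3}_{L²})
  [Gagliardo–Nirenberg + support contraction r → 0], while the non-linear injection grows at O(‖ω‖_∞‖ω‖²₂)» —
  typed as the rate bound `ν‖∇ω(t)‖² ≤ C₃ (‖ω(t)‖²)^{2/3}` along the solution; functions face `Step7F` alongside.
* (7) `Step8_DiffIneq7` · p.2 l.67–75 · `d/dt‖ω‖² ≥ C₂‖ω‖_∞‖ω‖² − ν‖∇ω‖²` AS PRINTED (coefficient `ν`); what
  (5)∧(6) give is the same with `2ν` (`diffIneq7_of_steps`, PROVED: `C₂ = 2C₁`) — misprint-grade, recorded.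
* (8) `Step9_Reduction8` · §6 p.3 l.3–9 · «Because the power of the non-linear self-stretching strictly
  dominates the power of viscous dissipation within the compact topological neighborhood, the governing equation
  in the asymptotic regime (t → T*) reduces mathematically to dY/dt ≥ K·Y^p, p > 1» — the inference
  (7) [any dissipation coefficient `c ≥ 0`] ∧ §5-rates ⇒ (8) on a final segment `[t₁, ·)` with `Y(t₁) > 0`,
  constants of the datum («asymptotic regime» = `∃ t₁`; `T*` is what (8) is meant to produce).
* `Step10_Divergence` · p.3 l.12–15 «The solution to this differential equation diverges to infinity in finite
  time T*» at the grain used (for the flow from the datum): (8) ⇒ a regular solution from the datum on some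
  `[0,T*)`, `T* < ∞`, with diverging enstrophy — IMPLICIT content: local existence + maximality + the enstrophy
  continuation principle (classical for `ν > 0`). Its real-variable core `Step10A_ODE_abs` (comparison for
  `Y' ≥ KY^p`, `Y(t₁) > 0` ⇒ finite horizon) is true; recorded.
* `Step11_BKM` · p.3 l.16–19 «Because the L² norm diverges, the supremum norm L^∞ diverges even more
  aggressively» + (4) · enstrophy divergence at `T` ⇒ `∫₀ᵀ‖ω‖_∞ = ∞` — true at the solution grain; downstream
  of the claimed blow-up, not consumed. §7 p.3 («Empirical Quantum Verification») is not mathematics and is not typed.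

COMPOSITION — PROVED: `claim_of_steps : Step3_Datum → Step5_EnstrophyId → Step6_StretchLower → Step7_DissipRate →
Step9_Reduction8 → Step10_Divergence → ClaimedTheorem` ((5)∧(6) ⇒ (7) with `2ν` by `diffIneq7_of_steps`; (7)∧§5 ⇒
(8) is Step 9; (8) ⇒ divergence is Step 10; the datum by Step 3). `Step4`, `Step8` (literal (7)), `Step11`, the
functions faces and `Step10A` are recorded for the verdict table.
REV 2 (additive, referee R#2): `Step6F_perDatum` (per-datum functions face of (6) = its `t = 0` slice) with
`step6F_perDatum_of_fun` / `step6F_perDatum_of_sol`, and the discharge `step10A_holds : Step10A_ODE_abs`.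
REV 3 (additive, chair RULED 07:45:11Z/07:48:55Z): the printed GEOMETRY as hypotheses — `mirrorZ`, `IsOuroGeometry`,
`IsAlignedDatum`, `Step6G_StretchLower` (decl of record for the token), `Step6G_perDatum` + `step6G_perDatum_holds`
(the `t = 0` slice is a THEOREM on the printed class), `Step3G_Datum`, `step6G_of_step6`, `claim_of_stepsG`,
`stretchI_pos_of_aligned`, `step6_t0_of_aligned`, `neg_not_geometry`, `neg_not_aligned`; and `step11_holds : Step11_BKM`.

WHAT THIS IS NOT: not a claim about NS regularity or blow-up; not a claim about any author beyond the typed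
locator.
-/

noncomputable section

open Set Function Filter MeasureTheory
open scoped Topology ENNReal NNReal ContDiff Laplacian InnerProductSpace

namespace Literature.Claims.NS.LucardoOlivaes2026

open Literature.Analysis.FluidPDE
open Literature.Claims.NS.Chae2007 (IsDatum IsLocalSolution)

/-! ### Vocabulary (definitions with bodies; nothing asserted) -/

/-- `ℝ³` (plumbing). [folklore] -/
abbrev E3 : Type := EuclideanSpace ℝ (Fin 3)

/-- `Y(t) = ‖ω(t)‖²_{L²}`, `ω = ∇ × u` — the enstrophy of §4 («the square of the L² norm of vorticity»,
p.2 l.28–29; `Y` of (8) p.3 l.10). [cite: LucardoOlivaes2026, §4 p.2 l.27–29; (8) p.3] -/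
def ensq (u : ℝ → E3 → E3) (t : ℝ) : ℝ := ∫ x, ‖curl (u t) x‖ ^ 2

/-- `‖∇ω(t)‖²_{L²}` ((5), (7) p.2; operator norm of the Fréchet derivative of `ω(t)`).
[cite: LucardoOlivaes2026, (5) p.2] -/
def vortgradsq (u : ℝ → E3 → E3) (t : ℝ) : ℝ := ∫ x, ‖fderiv ℝ (curl (u t)) x‖ ^ 2

/-- `‖ω(t)‖_{L^∞} = sup_x |ω(x,t)|` ((4), (6), (7) p.2; a genuine supremum for the regular solutions typed
here — continuous vorticity, bounded on each slice; junk `0` otherwise). [cite: LucardoOlivaes2026, (4) p.2] -/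
def supVort (u : ℝ → E3 → E3) (t : ℝ) : ℝ := ⨆ x, ‖curl (u t) x‖

/-- The vortex-stretching integral `∫_{ℝ³} ω·(ω·∇)v dV` of a field `v`, `ω = ∇ × v`, with `(ω·∇)v = Dv(ω)`
((5)–(6) p.2). [cite: LucardoOlivaes2026, (5)–(6) p.2] -/
def stretchI (v : E3 → E3) : ℝ := ∫ x, ⟪curl v x, fderiv ℝ v x (curl v x)⟫_ℝ

/-- **The «Ouroboros» datum of §3 as the CLASS of its printed analytic content** (p.1 l.42–45 «u₀ ∈ H^m(ℝ³)
with m ≥ 3, guaranteeing initial smoothness»; p.2 l.13–14 «the initial vorticity field ω₀ is localized in two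
anti-parallel vortex rings»): smooth, divergence free, every derivative in `L²` (the cell's `Chae2007.IsDatum`),
vorticity compactly supported and not identically zero. The geometric prose (Modulo-9 knot, rings colliding at
`z = 0`, `u_r < 0` near the node, alignment of `ω` with the top eigenvector of `S`) has no printed formula and
is not typed. [cite: LucardoOlivaes2026, §2 p.1 l.42–45; §3 p.2 l.12–26] -/
def IsOuroDatum (v₀ : E3 → E3) : Prop :=
  IsDatum v₀ ∧ HasCompactSupport (curl v₀) ∧ curl v₀ ≠ 0

/-- «enstrophy diverges in finite time» at the horizon `T` (abstract p.1 l.15–16; §6 p.3 l.12–15): `‖ω(t)‖²_{L²}`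
is unbounded on `[0,T)`. [cite: LucardoOlivaes2026, abstract p.1 l.15–16; §6 p.3 l.12–15] -/
def EnstrophyDiverges (u : ℝ → E3 → E3) (T : ℝ) : Prop :=
  ∀ M : ℝ, ∃ t ∈ Ico 0 T, M < ensq u t

/-- The differential inequality (7) p.2 along every regular solution from `v₀` at viscosity `ν`, with
dissipation coefficient `c` (printed: `c = ν`; from (5)∧(6): `c = 2ν`): there is `C₂ > 0` with
`d/dt‖ω‖² ≥ C₂‖ω‖_∞‖ω‖² − c‖∇ω‖²` at every interior time (the derivative exists). [cite: LucardoOlivaes2026, (7) p.2 l.67–75] -/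
def DiffIneq7 (ν c : ℝ) (v₀ : E3 → E3) : Prop :=
  ∃ C₂ : ℝ, 0 < C₂ ∧ ∀ (T : ℝ) (u : ℝ → E3 → E3) (p : ℝ → E3 → ℝ), IsLocalSolution ν T v₀ u p →
    ∀ t ∈ Ioo 0 T, ∃ D : ℝ, HasDerivAt (ensq u) D t ∧ C₂ * supVort u t * ensq u t - c * vortgradsq u t ≤ D

/-- The §5 rate sentence p.2 l.61–66 along every regular solution from `v₀`: «the viscous term … grows at a
thermodynamic rate O(‖ω‖^{4/3}_{L²})» — `ν‖∇ω(t)‖² ≤ C₃ (‖ω(t)‖²_{L²})^{2/3}` for a constant of the datum.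
[cite: LucardoOlivaes2026, §5 p.2 l.56–66] -/
def DissipRate (ν : ℝ) (v₀ : E3 → E3) : Prop :=
  ∃ C₃ : ℝ, 0 ≤ C₃ ∧ ∀ (T : ℝ) (u : ℝ → E3 → E3) (p : ℝ → E3 → ℝ), IsLocalSolution ν T v₀ u p →
    ∀ t ∈ Ico 0 T, ν * vortgradsq u t ≤ C₃ * (ensq u t) ^ (2 / 3 : ℝ)

/-- (8) p.3 l.7–12 «in the asymptotic regime»: constants `K > 0`, `p > 1` and an onset time `t₁ ≥ 0` of the
datum such that every regular solution from `v₀` living past `t₁` has `Y(t₁) > 0` and `dY/dt ≥ K·Y^p` on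
`(t₁, T)` (the derivative exists). [cite: LucardoOlivaes2026, (8) p.3 l.3–12] -/
def ODE8 (ν : ℝ) (v₀ : E3 → E3) : Prop :=
  ∃ K : ℝ, 0 < K ∧ ∃ q : ℝ, 1 < q ∧ ∃ t₁ : ℝ, 0 ≤ t₁ ∧
    ∀ (T : ℝ) (u : ℝ → E3 → E3) (p : ℝ → E3 → ℝ), IsLocalSolution ν T v₀ u p → t₁ < T →
      0 < ensq u t₁ ∧ ∀ t ∈ Ioo t₁ T, ∃ D : ℝ, HasDerivAt (ensq u) D t ∧ K * (ensq u t) ^ q ≤ D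

/-! ### The claimed statement -/

/-- **Abstract p.1 l.10–16 with §6 p.3 l.12–15 («enstrophy diverges in finite time T*»), as printed, in the
author's setting** (`ℝ³`, `F ≡ 0`, one `ν > 0`, datum of the printed class): for every `ν > 0` there are an
Ouroboros-class datum `v₀`, a finite `T* > 0` and a regular solution of (1)–(2) from `v₀` on `ℝ³ × [0,T*)`
whose enstrophy `‖ω(t)‖²_{L²}` is unbounded as `t → T*`.
[cite: LucardoOlivaes2026, abstract p.1 l.8–18; §6 p.3 l.1–22] [claim: LucardoOlivaes2026, status: disputed] -/
def ClaimedTheorem : Prop :=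
  ∀ ν : ℝ, 0 < ν → ∃ v₀ : E3 → E3, IsOuroDatum v₀ ∧ ∃ T : ℝ, 0 < T ∧
    ∃ (u : ℝ → E3 → E3) (p : ℝ → E3 → ℝ), IsLocalSolution ν T v₀ u p ∧ EnstrophyDiverges u T

/-! ### The paper's steps (no assertion) -/

/-- **§3 p.2 l.12–26 — the construction** («we define u₀(x) as an interacting Ouroboros vortex knot … ω₀ is
localized in two anti-parallel vortex rings colliding at the plane z = 0»), at the grain of its printed analytic
content: a datum of the class EXISTS. True (e.g. the curl of a smooth compactly supported vector potential).
[cite: LucardoOlivaes2026, §3 p.2 l.12–26] -/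
def Step3_Datum : Prop :=
  ∃ v₀ : E3 → E3, IsOuroDatum v₀

/-- **(3) p.2 l.1–4 — the vorticity equation** «∂ω/∂t + (u·∇)ω = (ω·∇)u + νΔω» along every regular solution
(one-sided time derivative within `[0,T)`). True (curl of (1); classical). [cite: LucardoOlivaes2026, (3) p.2 l.1–4] -/
def Step4_VorticityEq : Prop :=
  ∀ ν : ℝ, 0 < ν → ∀ (T : ℝ) (v₀ : E3 → E3) (u : ℝ → E3 → E3) (p : ℝ → E3 → ℝ), IsLocalSolution ν T v₀ u p →
    ∀ t ∈ Ico 0 T, ∀ x,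
      timeDerivWithin (Ico 0 T) (fun s y => curl (u s) y) t x + convect (u t) (curl (u t)) x
        = fderiv ℝ (u t) x (curl (u t) x) + ν • Δ (curl (u t)) x

/-- **(5) p.2 l.27–43 — the enstrophy identity** «Multiplying the vorticity equation by ω and integrating over
the spatial volume ℝ³: ½ d/dt‖ω‖²_{L²} = ∫_{ℝ³} ω·(ω·∇)u dV − ν‖∇ω‖²_{L²}», along every regular solution at
interior times. True (classical, for the decaying smooth slices of the class). [cite: LucardoOlivaes2026, (5) p.2 l.27–43] -/
def Step5_EnstrophyId : Prop :=
  ∀ ν : ℝ, 0 < ν → ∀ (T : ℝ) (v₀ : E3 → E3) (u : ℝ → E3 → E3) (p : ℝ → E3 → ℝ), IsLocalSolution ν T v₀ u p →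
    ∀ t ∈ Ioo 0 T, HasDerivAt (fun s => (1 / 2 : ℝ) * ensq u s) (stretchI (u t) - ν * vortgradsq u t) t

/-- **(6) §4.1 p.2 l.44–54 — the stretching LOWER bound** «We bound the stretching strictly from below in a
concentrated region Ω_r: ∫_{ℝ³} ω·(ω·∇)u dV ≥ C₁‖ω‖_{L^∞}‖ω‖²_{L²}», `C₁ > 0` a constant of the datum, at
every time of every regular solution from an Ouroboros-class datum (no derivation printed; the justification is
§3's prose «the stretching matrix S maintains a dominant positive eigenvalue λ(t) aligned with ω», p.2 l.19–26,
l.45–48). Census/CARD-PREDICTED locator. [cite: LucardoOlivaes2026, (6) p.2 l.44–54] -/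
def Step6_StretchLower : Prop :=
  ∀ ν : ℝ, 0 < ν → ∀ v₀ : E3 → E3, IsOuroDatum v₀ → ∃ C₁ : ℝ, 0 < C₁ ∧
    ∀ (T : ℝ) (u : ℝ → E3 → E3) (p : ℝ → E3 → ℝ), IsLocalSolution ν T v₀ u p →
      ∀ t ∈ Ico 0 T, C₁ * supVort u t * ensq u t ≤ stretchI (u t)

/-- **(6), FUNCTIONS face** — the display read as the inequality between the functionals it names, over the
fields of the datum class (what (6) asserts of each slice `v = u(t)`; at `t = 0` the solution-grain Step 6
asserts exactly `0 < C₁‖curl v₀‖_∞‖curl v₀‖² ≤ stretchI v₀` for every datum `v₀` of the class): there is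
`C₁ > 0` with `C₁‖∇×v‖_∞‖∇×v‖²_{L²} ≤ ∫(∇×v)·((∇×v)·∇)v` for every Ouroboros-class field. Kernel handle for the
refuter (the left side is even and the right side odd under `v ↦ −v`); not consumed by the composition.
[cite: LucardoOlivaes2026, (6) p.2 l.44–54] -/
def Step6F_StretchLower_fun : Prop :=
  ∃ C₁ : ℝ, 0 < C₁ ∧ ∀ v : E3 → E3, IsOuroDatum v →
    C₁ * (⨆ x, ‖curl v x‖) * (∫ x, ‖curl v x‖ ^ 2) ≤ stretchI v

/-- **§5 p.2 l.56–66 — the rate sentence** («we utilize the Gagliardo-Nirenberg inequality. Due to the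
cylindrical contraction … the support of the vorticity contracts to r → 0. The viscous term … grows at a
thermodynamic rate O(‖ω‖^{4/3}_{L²}), while the non-linear injection grows at a superior geometric rate
O(‖ω‖_{L^∞}‖ω‖²_{L²})»): along every regular solution from an Ouroboros-class datum the dissipation obeys
`ν‖∇ω(t)‖²_{L²} ≤ C₃ (‖ω(t)‖²_{L²})^{2/3}` (an UPPER bound of `‖∇ω‖` by a power of `‖ω‖`, attributed to
Gagliardo–Nirenberg). [cite: LucardoOlivaes2026, §5 p.2 l.56–66] -/
def Step7_DissipRate : Prop :=
  ∀ ν : ℝ, 0 < ν → ∀ v₀ : E3 → E3, IsOuroDatum v₀ → DissipRate ν v₀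

/-- **§5, FUNCTIONS face** — «by Gagliardo–Nirenberg»: the rate bound as an inequality between functionals of
a field, `ν∫‖∇(∇×v)‖² ≤ C₃ (∫‖∇×v‖²)^{2/3}` over the datum class (inhomogeneous of degrees `2` vs `4/3` under
`v ↦ A v`). Kernel handle for the refuter; not consumed by the composition. [cite: LucardoOlivaes2026, §5 p.2 l.56–66] -/
def Step7F_DissipRate_fun : Prop :=
  ∀ ν : ℝ, 0 < ν → ∃ C₃ : ℝ, 0 ≤ C₃ ∧ ∀ v : E3 → E3, IsOuroDatum v →
    ν * ∫ x, ‖fderiv ℝ (curl v) x‖ ^ 2 ≤ C₃ * (∫ x, ‖curl v x‖ ^ 2) ^ (2 / 3 : ℝ)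

/-- **(7) p.2 l.67–75 AS PRINTED** — «This establishes the differential inequality
d/dt‖ω‖²_{L²} ≥ C₂‖ω‖_{L^∞}‖ω‖²_{L²} − ν‖∇ω‖²_{L²}» (dissipation coefficient `ν`; clearing the `½` of (5)
gives `2ν` — see `diffIneq7_of_steps`; misprint-grade, recorded). [cite: LucardoOlivaes2026, (7) p.2 l.67–75] -/
def Step8_DiffIneq7 : Prop :=
  ∀ ν : ℝ, 0 < ν → ∀ v₀ : E3 → E3, IsOuroDatum v₀ → DiffIneq7 ν ν v₀

/-- **§6 p.3 l.3–9 — the reduction to (8)** «Because the power of the non-linear self-stretching strictly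
dominates the power of viscous dissipation within the compact topological neighborhood, the governing equation
in the asymptotic regime (t → T*) reduces mathematically to: dY(t)/dt ≥ K·[Y(t)]^p, p > 1 (8) Where
Y(t) = ‖ω‖²_{L²} and K > 0»: from the differential inequality (7) (whatever its dissipation coefficient
`c ≥ 0` — the inference DROPS the dissipation by «dominance») and the §5 rates, the ODE (8) on a final time
segment, with constants of the datum. [cite: LucardoOlivaes2026, §6 p.3 l.3–12 with §5 p.2 l.56–66] -/
def Step9_Reduction8 : Prop :=
  ∀ ν : ℝ, 0 < ν → ∀ v₀ : E3 → E3, IsOuroDatum v₀ →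
    ∀ c : ℝ, 0 ≤ c → DiffIneq7 ν c v₀ → DissipRate ν v₀ → ODE8 ν v₀

/-- **§6 p.3 l.12–15 — «The solution to this differential equation diverges to infinity in finite time T*»**,
at the grain USED (for the flow from the datum, `T*` being produced here): (8) for the regular solutions from
an Ouroboros-class datum ⇒ a regular solution from it on some `[0,T*)`, `0 < T* < ∞`, whose enstrophy
diverges as `t → T*`. IMPLICIT content beyond the ODE fact `Step10A_ODE_abs`: local existence, maximality and
the enstrophy continuation principle for `ν > 0` (classical; tree: `kato_local_holds`,
`hasSobolevExtensionPast_of_uniform_H1_bound`). [cite: LucardoOlivaes2026, §6 p.3 l.12–15] -/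
def Step10_Divergence : Prop :=
  ∀ ν : ℝ, 0 < ν → ∀ v₀ : E3 → E3, IsOuroDatum v₀ → ODE8 ν v₀ →
    ∃ T : ℝ, 0 < T ∧ ∃ (u : ℝ → E3 → E3) (p : ℝ → E3 → ℝ), IsLocalSolution ν T v₀ u p ∧ EnstrophyDiverges u T

/-- **The ODE fact behind p.3 l.12–15, REAL-VARIABLE grain**: a function `Y`, continuous on `[t₁, T)`,
differentiable on `(t₁, T)` with `Y' ≥ K·Y^q` there, `Y(t₁) > 0`, `K > 0`, `q > 1`, cannot live past
`t₁ + Y(t₁)^{1−q}/((q−1)K)`. True (comparison with `Z' = KZ^q`); recorded, not consumed.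
[cite: LucardoOlivaes2026, (8) and l.12–15 p.3] -/
def Step10A_ODE_abs : Prop :=
  ∀ (K q t₁ T : ℝ) (Y : ℝ → ℝ), 0 < K → 1 < q → t₁ < T → ContinuousOn Y (Ico t₁ T) → 0 < Y t₁ →
    (∀ t ∈ Ioo t₁ T, ∃ D : ℝ, HasDerivAt Y D t ∧ K * (Y t) ^ q ≤ D) →
      T ≤ t₁ + (Y t₁) ^ (1 - q) / ((q - 1) * K)

/-- **p.3 l.16–19 — «Because the L² norm diverges, the supremum norm L^∞ diverges even more aggressively.
Evaluating under the rigorous Beale-Kato-Majda theorem, the necessary and sufficient condition [(4)] … is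
fulfilled»**: along a regular solution from an Ouroboros-class datum, enstrophy divergence at `T` forces
`∫₀ᵀ‖ω(·,t)‖_{L^∞} dt = ∞`. True at this grain (bounded `∫‖ω‖_∞` keeps the `H¹`/enstrophy norm bounded);
downstream of the claimed blow-up, not consumed. [cite: LucardoOlivaes2026, p.3 l.16–19 with (4) p.2 l.5–11] -/
def Step11_BKM : Prop :=
  ∀ ν : ℝ, 0 < ν → ∀ (T : ℝ) (v₀ : E3 → E3) (u : ℝ → E3 → E3) (p : ℝ → E3 → ℝ), IsLocalSolution ν T v₀ u p →
    IsOuroDatum v₀ → EnstrophyDiverges u T → (∫⁻ t in Ioo 0 T, ⨆ x, ‖curl (u t) x‖ₑ) = ⊤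

/-! ### Kernel compositions (the paper's own implications; PROVED) -/

/-- **(5) ∧ (6) ⇒ (7) with dissipation coefficient `2ν`** (`C₂ = 2C₁`): clearing the `½` of (5),
`d/dt‖ω‖² = 2∫ω·(ω·∇)u − 2ν‖∇ω‖² ≥ 2C₁‖ω‖_∞‖ω‖² − 2ν‖∇ω‖²`. Pure algebra; records that the printed (7)
(coefficient `ν`, `Step8_DiffIneq7`) differs from what its premises give by the factor `2` on the dissipation.
[cite: LucardoOlivaes2026, (5)–(7) p.2] -/
theorem diffIneq7_of_steps (h5 : Step5_EnstrophyId) (h6 : Step6_StretchLower) :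
    ∀ ν : ℝ, 0 < ν → ∀ v₀ : E3 → E3, IsOuroDatum v₀ → DiffIneq7 ν (2 * ν) v₀ := by
  intro ν hν v₀ hD
  obtain ⟨C₁, hC₁, H6⟩ := h6 ν hν v₀ hD
  refine ⟨2 * C₁, by positivity, fun T u p hsol t ht => ?_⟩
  have hd := h5 ν hν T v₀ u p hsol t ht
  have hd2 : HasDerivAt (ensq u) (2 * (stretchI (u t) - ν * vortgradsq u t)) t := by
    have h := hd.const_mul (2 : ℝ)
    simp only [← mul_assoc] at h
    norm_num at h
    exact h
  refine ⟨_, hd2, ?_⟩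
  have h6t := H6 T u p hsol t ⟨ht.1.le, ht.2⟩
  linarith

/-- **COMPOSITION (PROVED)** — the printed logic composes GIVEN its steps: the datum (§3, Step 3), the
enstrophy identity (5) and the stretching bound (6) give (7) with coefficient `2ν` (`diffIneq7_of_steps`); the
§5 rates (Step 7) and the dominance reduction (Step 9) give (8); «the solution of (8) diverges in finite time»
(Step 10) gives the claimed enstrophy divergence at a finite `T*`. [cite: LucardoOlivaes2026, §§3–6 pp.2–3] -/
theorem claim_of_steps (h3 : Step3_Datum) (h5 : Step5_EnstrophyId) (h6 : Step6_StretchLower)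
    (h7 : Step7_DissipRate) (h9 : Step9_Reduction8) (h10 : Step10_Divergence) : ClaimedTheorem := by
  intro ν hν
  obtain ⟨v₀, hD⟩ := h3
  have h7' := diffIneq7_of_steps h5 h6 ν hν v₀ hD
  have h8 : ODE8 ν v₀ := h9 ν hν v₀ hD (2 * ν) (by positivity) h7' (h7 ν hν v₀ hD)
  exact ⟨v₀, hD, h10 ν hν v₀ hD h8⟩

/-- The literal (7) (coefficient `ν`) also feeds Step 9 (any `c ≥ 0`): the composition from the printed
display in place of (5)∧(6). [cite: LucardoOlivaes2026, (7) p.2, §6 p.3] -/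
theorem claim_of_steps_literal7 (h3 : Step3_Datum) (h8 : Step8_DiffIneq7) (h7 : Step7_DissipRate)
    (h9 : Step9_Reduction8) (h10 : Step10_Divergence) : ClaimedTheorem := by
  intro ν hν
  obtain ⟨v₀, hD⟩ := h3
  have h8' : ODE8 ν v₀ := h9 ν hν v₀ hD ν hν.le (h8 ν hν v₀ hD) (h7 ν hν v₀ hD)
  exact ⟨v₀, hD, h10 ν hν v₀ hD h8'⟩

/-! ### Clay link (TYPING-HYGIENE 10 (b)): (C) from an Ouroboros datum OF CLASS (4) -/

/-- **An enstrophy divergence along a regular solution from an Ouroboros-class datum that is ALSO of Clay's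
class (4) (rapid decay) proves Clay (C)** (`NavierStokesBreakdownR3`), by the tree's enstrophy blow-up
certificate (finite energy on `[0,T)` from the energy inequality in the BKM class). The rapid-decay hypothesis
is the Δ4 delta: the printed data class `H^m`, `m ≥ 3` does not assert it.
[cite: LucardoOlivaes2026, §6 p.3] [cite: FeffermanClay2006, (C) p.2] -/
theorem clay_of_divergence {ν T : ℝ} {v₀ : E3 → E3} {u : ℝ → E3 → E3} {p : ℝ → E3 → ℝ} (hν : 0 < ν)
    (hD : IsOuroDatum v₀) (hdec : HasRapidSpatialDecay v₀) (hsol : IsLocalSolution ν T v₀ u p)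
    (hdiv : EnstrophyDiverges u T) :
    Summit.NavierStokesRegularity.NavierStokesRegularity.NavierStokesBreakdownR3 := by
  have hdat : IsDatum v₀ := hD.1
  -- `∫⁻ |u(τ)|² = ofReal ∫ |u(τ)|²` on each closed sub-slab `[0,S]`, `S < T`
  have key : ∀ S : ℝ, 0 < S → S < T → ∀ τ ∈ Icc (0:ℝ) S,
      ∫⁻ x, ‖u τ x‖ₑ ^ 2 = ENNReal.ofReal (∫ x, ‖u τ x‖ ^ 2) := by
    intro S hS hST τ hτ
    have hcl : IsClassicalNSSolutionOn (Icc 0 S) ν 0 u p :=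
      hsol.isClassical.mono (Icc_subset_Ico_right hST) (uniqueDiffOn_Icc hS)
    obtain ⟨C, hC⟩ := hsol.sobolev S hST 0
    have hfin0 : ∫⁻ x, ‖iteratedFDeriv ℝ 0 (u τ) x‖ₑ ^ 2 < ⊤ := (hC τ hτ).trans_lt ENNReal.coe_lt_top
    have heq : (fun x => ‖iteratedFDeriv ℝ 0 (u τ) x‖ₑ ^ 2) = fun x => ‖u τ x‖ₑ ^ 2 := by
      funext x
      rw [← ofReal_norm, norm_iteratedFDeriv_zero, ofReal_norm]
    have hfin : ∫⁻ x, ‖u τ x‖ₑ ^ 2 < ⊤ := by rwa [heq] at hfin0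
    have hint : Integrable (fun x => ‖u τ x‖ ^ 2) :=
      integrable_sq_norm_of_lintegral_lt_top (hcl.contDiff_velocity hτ).continuous hfin
    rw [ofReal_integral_eq_lintegral_ofReal hint (Eventually.of_forall fun x => sq_nonneg _)]
    refine lintegral_congr fun x => ?_
    rw [← ofReal_norm, ENNReal.ofReal_pow (norm_nonneg _)]
  -- the datum has finite energy
  have h0 : ∫⁻ x, ‖v₀ x‖ₑ ^ 2 < ⊤ := by
    have h := hdat.2.2 0
    have heq : (fun x => ‖iteratedFDeriv ℝ 0 v₀ x‖ₑ ^ 2) = fun x => ‖v₀ x‖ₑ ^ 2 := by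
      funext x
      rw [← ofReal_norm, norm_iteratedFDeriv_zero, ofReal_norm]
    rwa [heq] at h
  -- finite energy on `[0,T)` by the energy inequality in the BKM class
  have hE : ∃ A : ℝ≥0∞, A < ⊤ ∧ ∀ t ∈ Ico 0 T, ∫⁻ x, ‖u t x‖ₑ ^ 2 ≤ A := by
    refine ⟨∫⁻ x, ‖v₀ x‖ₑ ^ 2, h0, fun t ht => ?_⟩
    rcases ht.1.eq_or_lt with h00 | hpos
    · rw [← h00, hsol.initial]
    · -- a closed sub-slab `[0,S]` with `t ≤ S < T`
      obtain ⟨S, htS, hST⟩ : ∃ S, t < S ∧ S < T := exists_between ht.2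
      have hS : 0 < S := hpos.trans htS
      have hcl : IsClassicalNSSolutionOn (Icc 0 S) ν 0 u p :=
        hsol.isClassical.mono (Icc_subset_Ico_right hST) (uniqueDiffOn_Icc hS)
      have hle : ∫ x, ‖u t x‖ ^ 2 ≤ ∫ x, ‖u 0 x‖ ^ 2 :=
        hcl.bkm_energy_le hν.le hS ((hsol.sobolev S hST).mono le_rfl) ⟨ht.1, htS.le⟩
      rw [key S hS hST t ⟨ht.1, htS.le⟩, ← hsol.initial, key S hS hST 0 ⟨le_rfl, hS.le⟩]
      exact ENNReal.ofReal_le_ofReal hle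
  exact ClayVariants.navierStokesBreakdownR3_of_enstrophyBlowupCertificate hν hdat.1 (fun x => hdat.2.1 x)
    hdec hsol.isClassical hsol.initial hE hdiv

/-! ### Rev 2 (ADDITIVE — referee ref-1 g4 PRE-READ 2026-08-27T07:37:11Z, R#2; nothing above is touched):
the PER-DATUM functions face of (6) (= what (6) asserts of the slice `t = 0`), its two bridges, and the
kernel discharge of the recorded ODE fact `Step10A_ODE_abs`. -/

/-- **(6), PER-DATUM functions face** (referee's charitable R#2; TYPING-HYGIENE 13 companion): for every
field of the Ouroboros class there is `C₁ > 0` with `C₁‖∇×v‖_∞‖∇×v‖²_{L²} ≤ ∫(∇×v)·((∇×v)·∇)v` — the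
constant PER DATUM as printed («a constant» of «our specific topological configuration»), i.e. exactly what
the solution-grain `Step6_StretchLower` says of the initial slice `t = 0` (`step6F_perDatum_of_sol`), and a
consequence of the uniform face (`step6F_perDatum_of_fun`). Kernel handle; not consumed by `claim_of_steps`.
[cite: LucardoOlivaes2026, (6) p.2 l.44–54] -/
def Step6F_perDatum : Prop :=
  ∀ v : E3 → E3, IsOuroDatum v →
    ∃ C₁ : ℝ, 0 < C₁ ∧ C₁ * (⨆ x, ‖curl v x‖) * (∫ x, ‖curl v x‖ ^ 2) ≤ stretchI v

/-- The uniform functions face implies the per-datum one (pure logic). [cite: LucardoOlivaes2026, (6) p.2 l.44–54] -/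
theorem step6F_perDatum_of_fun (h : Step6F_StretchLower_fun) : Step6F_perDatum := by
  intro v hv
  obtain ⟨C₁, hC₁, H⟩ := h
  exact ⟨C₁, hC₁, H v hv⟩

/-- **The solution-grain (6) at `t = 0` IS the per-datum face**, given classical local existence in the class
(taken as a HYPOTHESIS here — Kato 1972 / Majda–Bertozzi Thm 3.4 for `H^m`, `m ≥ 3` data; no fact is minted):
the initial slice of the regular solution is the datum (`IsLocalSolution.initial`).
[cite: LucardoOlivaes2026, (6) p.2 l.44–54 with §2 p.1 l.42–45] -/
theorem step6F_perDatum_of_sol (h6 : Step6_StretchLower)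
    (hex : ∀ ν : ℝ, 0 < ν → ∀ v₀ : E3 → E3, IsOuroDatum v₀ →
      ∃ T : ℝ, 0 < T ∧ ∃ (u : ℝ → E3 → E3) (p : ℝ → E3 → ℝ), IsLocalSolution ν T v₀ u p) :
    Step6F_perDatum := by
  intro v hv
  obtain ⟨C₁, hC₁, H⟩ := h6 1 one_pos v hv
  obtain ⟨T, hT, u, p, hsol⟩ := hex 1 one_pos v hv
  have h0 := H T u p hsol 0 ⟨le_rfl, hT⟩
  have hu0 : u 0 = v := hsol.initial
  simp only [supVort, ensq, hu0] at h0
  exact ⟨C₁, hC₁, h0⟩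

/-- The explicit blow-up profile `Z(t) = (c − m (t − a))^{−1/(q−1)}` solves `Z' = (m/(q−1))·Z^q` where the
base is positive (proof device). [folklore] -/
private theorem hasDerivAt_profile {c m a q t : ℝ} (hq : 1 < q) (hpos : 0 < c - m * (t - a)) :
    HasDerivAt (fun s => (c - m * (s - a)) ^ (-1 / (q - 1)))
      (m / (q - 1) * ((c - m * (t - a)) ^ (-1 / (q - 1))) ^ q) t := by
  have hq1 : q - 1 ≠ 0 := by linarith
  have hg : HasDerivAt (fun s => c - m * (s - a)) (-m) t := by
    have h1 : HasDerivAt (fun s => m * (s - a)) (m * 1) t :=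
      ((hasDerivAt_id t).sub_const a).const_mul m
    have h2 := h1.const_sub c
    simpa using h2
  have h := hg.rpow_const (p := -1 / (q - 1)) (Or.inl hpos.ne')
  have hexp : ((c - m * (t - a)) ^ (-1 / (q - 1))) ^ q = (c - m * (t - a)) ^ (-1 / (q - 1) - 1) := by
    rw [← Real.rpow_mul hpos.le]
    congr 1
    field_simp
    ring
  rw [hexp]
  convert h using 1
  field_simp

/-- **The ODE comparison fact `Step10A_ODE_abs` holds**: if `Y` is continuous on `[t₁,T)`, `Y(t₁) > 0`, and
`Y' ≥ K·Y^q` on `(t₁,T)` (`K > 0`, `q > 1`), then `T ≤ t₁ + Y(t₁)^{1−q}/((q−1)K)` — comparison with the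
explicit sub-solutions `Z' = K'Z^q`, `K' < K`, started just after `t₁` (Mathlib's fencing lemma
`image_le_of_deriv_right_lt_deriv_boundary'`), which blow up before `T` otherwise.
[cite: LucardoOlivaes2026, (8) and l.12–15 p.3] -/
theorem step10A_holds : Step10A_ODE_abs := by
  intro K q t₁ T Y hK hq ht₁T hYc hY0 hode
  by_contra hcon0
  have hcon := not_le.mp hcon0
  have hq1 : 0 < q - 1 := by linarith
  set L : ℝ := (Y t₁) ^ (1 - q) / ((q - 1) * K) with hL
  have hL0 : 0 < L := by positivity
  set G : ℝ := T - t₁ with hG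
  have hLG : L < G := by rw [hG]; linarith
  -- a rate `K' = θK < K` whose blow-up horizon from `t₁` is still `< T`
  set θ : ℝ := (L + G) / (2 * G) with hθ
  have hθpos : 0 < θ := by positivity
  have hθ1 : θ < 1 := by rw [hθ, div_lt_one (by positivity)]; linarith
  set K' : ℝ := θ * K with hK'
  have hK'0 : 0 < K' := by positivity
  have hK'K : K' < K := by rw [hK']; nlinarith
  have hGpos : 0 < G := lt_trans hL0 hLG
  have hLθ : L / θ < G := by
    have hθ' : L / θ = 2 * G * L / (L + G) := by
      rw [hθ]
      field_simp
    rw [hθ', div_lt_iff₀ (by positivity)]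
    nlinarith
  -- the horizon function `φ a = (a - t₁) + Y(a)^{1-q}/((q-1)K')`, continuous at `t₁` within `[t₁,T)`
  have hφ : ContinuousWithinAt (fun a => (a - t₁) + (Y a) ^ (1 - q) / ((q - 1) * K')) (Ico t₁ T) t₁ := by
    have h1 : ContinuousWithinAt Y (Ico t₁ T) t₁ := hYc t₁ ⟨le_rfl, ht₁T⟩
    have h2 : ContinuousWithinAt (fun a => (Y a) ^ (1 - q)) (Ico t₁ T) t₁ :=
      h1.rpow_const (Or.inl hY0.ne')
    exact ((continuousWithinAt_id.sub continuousWithinAt_const)).add (h2.div_const _)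
  have hφ0 : (t₁ - t₁) + (Y t₁) ^ (1 - q) / ((q - 1) * K') < G := by
    have : (Y t₁) ^ (1 - q) / ((q - 1) * K') = L / θ := by
      rw [hL, hK']
      field_simp
    rw [sub_self, zero_add, this]
    exact hLθ
  have hev : ∀ᶠ a in 𝓝[Ico t₁ T] t₁,
      (a - t₁) + (Y a) ^ (1 - q) / ((q - 1) * K') < G ∧ 0 < Y a := by
    refine (hφ.eventually (gt_mem_nhds hφ0)).and ?_
    exact (hYc t₁ ⟨le_rfl, ht₁T⟩).eventually (lt_mem_nhds hY0)
  -- a point `a ∈ (t₁, T)` where both hold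
  haveI : (𝓝[Ioo t₁ T] t₁).NeBot := left_nhdsWithin_Ioo_neBot ht₁T
  obtain ⟨a, ⟨haφ, hYa⟩, ha⟩ :=
    ((hev.filter_mono (nhdsWithin_mono _ Ioo_subset_Ico_self)).and self_mem_nhdsWithin).exists
  -- the comparison profile from `(a, Y a)` with rate `K'`
  set c : ℝ := (Y a) ^ (1 - q) with hc
  set m : ℝ := (q - 1) * K' with hm
  have hc0 : 0 < c := Real.rpow_pos_of_pos hYa _
  have hm0 : 0 < m := by positivity
  set Tz : ℝ := a + c / m with hTz
  have hTzT : Tz < T := by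
    have : c / m = (Y a) ^ (1 - q) / ((q - 1) * K') := by rw [hc, hm]
    rw [hTz, this]
    have := haφ
    rw [hG] at this
    linarith
  have haTz : a < Tz := by rw [hTz]; linarith [div_pos hc0 hm0]
  set Z : ℝ → ℝ := fun s => (c - m * (s - a)) ^ (-1 / (q - 1)) with hZ
  have hbase : ∀ s, s < Tz → 0 < c - m * (s - a) := by
    intro s hs
    have : m * (s - a) < c := by
      rw [hTz] at hs
      have := (lt_div_iff₀' hm0).mp (by linarith : s - a < c / m)
      linarith
    linarith
  have hZpos : ∀ s, s < Tz → 0 < Z s := fun s hs => Real.rpow_pos_of_pos (hbase s hs) _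
  have hZa : Z a = Y a := by
    simp only [hZ, sub_self, mul_zero, sub_zero, hc]
    rw [← Real.rpow_mul hYa.le]
    have : (1 - q) * (-1 / (q - 1)) = 1 := by field_simp; ring
    rw [this, Real.rpow_one]
  -- `Y` is bounded on the compact `[a, Tz] ⊆ [t₁, T)`
  have hsub : Icc a Tz ⊆ Ico t₁ T := fun s hs => ⟨le_trans ha.1.le hs.1, lt_of_le_of_lt hs.2 hTzT⟩
  obtain ⟨M, hM⟩ := (isCompact_Icc (a := a) (b := Tz)).exists_bound_of_continuousOn (hYc.mono hsub)
  -- comparison on `[a, b]`, every `b < Tz`: `Z ≤ Y`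
  have hcomp : ∀ b, a < b → b < Tz → Z b ≤ Y b := by
    intro b hab hbT
    have hbsub : Icc a b ⊆ Ico t₁ T := fun s hs => hsub ⟨hs.1, hs.2.trans hbT.le⟩
    have hZc : ContinuousOn Z (Icc a b) := by
      intro s hs
      have hs' : 0 < c - m * (s - a) := hbase s (lt_of_le_of_lt hs.2 hbT)
      exact (((continuous_const.sub (continuous_const.mul (continuous_id.sub continuous_const)))
        |>.continuousAt).rpow_const (Or.inl hs'.ne')).continuousWithinAt
    have hZ' : ∀ s ∈ Ico a b, HasDerivWithinAt Z (K' * (Z s) ^ q) (Ici s) s := by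
      intro s hs
      have hs' : 0 < c - m * (s - a) := hbase s (lt_trans hs.2 hbT)
      have h := hasDerivAt_profile (c := c) (m := m) (a := a) hq hs'
      have hKm : m / (q - 1) = K' := by rw [hm]; field_simp
      rw [hKm] at h
      exact h.hasDerivWithinAt
    have hY' : ∀ s ∈ Ico a b, HasDerivWithinAt Y (deriv Y s) (Ici s) s := by
      intro s hs
      obtain ⟨D, hD, -⟩ := hode s ⟨lt_of_lt_of_le ha.1 hs.1, (hbsub ⟨hs.1, hs.2.le⟩).2⟩
      rw [hD.deriv]
      exact hD.hasDerivWithinAt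
    have hbound : ∀ s ∈ Ico a b, Z s = Y s → K' * (Z s) ^ q < deriv Y s := by
      intro s hs hZY
      obtain ⟨D, hD, hKD⟩ := hode s ⟨lt_of_lt_of_le ha.1 hs.1, (hbsub ⟨hs.1, hs.2.le⟩).2⟩
      rw [hD.deriv]
      have hZq : 0 < (Z s) ^ q := Real.rpow_pos_of_pos (hZpos s (lt_trans hs.2 hbT)) _
      rw [hZY] at hZq ⊢
      nlinarith
    exact image_le_of_deriv_right_lt_deriv_boundary' hZc hZ' (le_of_eq hZa)
      (hYc.mono hbsub) hY' hbound (right_mem_Icc.2 hab.le)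
  -- but `Z b → ∞` as `b → Tz⁻`: pick `b` with `Z b > M`
  set M' : ℝ := max M 1 with hM'
  have hM'1 : 1 ≤ M' := le_max_right _ _
  have hM'0 : 0 < M' := by linarith
  set δ : ℝ := min (c / 2) (M' ^ (-(q - 1)) / 2) with hδ
  have hδpos : 0 < δ := by positivity
  have hδc : δ < c := by
    have : δ ≤ c / 2 := min_le_left _ _
    linarith
  have hδM : δ < M' ^ (-(q - 1)) := by
    have h1 : δ ≤ M' ^ (-(q - 1)) / 2 := min_le_right _ _
    have h2 : 0 < M' ^ (-(q - 1)) := Real.rpow_pos_of_pos hM'0 _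
    linarith
  set b : ℝ := Tz - δ / m with hb
  have hab : a < b := by
    rw [hb, hTz]
    have : δ / m < c / m := div_lt_div_of_pos_right hδc hm0
    linarith
  have hbT : b < Tz := by rw [hb]; linarith [div_pos hδpos hm0]
  have hZb : Z b = δ ^ (-1 / (q - 1)) := by
    simp only [hZ]
    congr 1
    rw [hb, hTz]
    field_simp
    ring
  have hZbM : M' < Z b := by
    rw [hZb]
    have hneg : -1 / (q - 1) < 0 := by
      rw [div_neg_iff]; exact Or.inr ⟨by norm_num, hq1⟩
    have h1 : (M' ^ (-(q - 1))) ^ (-1 / (q - 1)) < δ ^ (-1 / (q - 1)) :=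
      Real.rpow_lt_rpow_of_neg hδpos hδM hneg
    have h2 : (M' ^ (-(q - 1))) ^ (-1 / (q - 1)) = M' := by
      rw [← Real.rpow_mul hM'0.le]
      have : (-(q - 1)) * (-1 / (q - 1)) = 1 := by field_simp
      rw [this, Real.rpow_one]
    rw [h2] at h1
    exact h1
  have hYb : Y b ≤ M := by
    have := hM b ⟨hab.le, hbT.le⟩
    rw [Real.norm_eq_abs] at this
    exact (le_abs_self _).trans this
  have := hcomp b hab hbT
  linarith [le_max_left M 1]

/-! ### Rev 3 (ADDITIVE — chair RULED 2026-08-27T07:45:11Z (2) / 07:48:55Z on referee ref-1 g4's PRE-READ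
SUPPLEMENT 07:42:54Z (RETYPE.md v0.3–v0.4, scratches 06f1b00e682362b8 / 1d6cbf4ca51518ef) and typist-12 g4's
2-READ 07:34:37Z): the printed GEOMETRY of §3 (p.2 l.12–26) as hypotheses of (6) — TYPING-HYGIENE 13 / F17:
«a step is typed at the grain the sentence uses WITH every printed property of its objects in the hypotheses».
Nothing above is touched. Predicate texts follow the referee's scratch (credited); the lemmas are re-proved here. -/

/-- Reflection in the collision plane `z = 0` (p.2 l.13–14 «colliding at the plane z = 0»).
[cite: LucardoOlivaes2026, §3 p.2 l.13–14] -/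
def mirrorZ (x : E3) : E3 := WithLp.toLp 2 ![x 0, x 1, -x 2]

/-- **The printed GEOMETRY of the Ouroboros datum** (§3 p.2 l.12–18, F17 reconstruction after the referee's
scratch 06f1b00e682362b8): (i) mirror-symmetric about the plane `z = 0` («two ANTI-PARALLEL vortex rings»:
the velocity is even under `z ↦ −z`, so the vorticity is odd), (ii) no swirl («in cylindrical coordinates
(r, θ, z)», `u_r`, `u_z` only: `⟪v, e_θ⟫ = 0`), (iii) no vorticity ON the plane (two separated rings), (iv) the
rings APPROACH the plane («colliding»: on the axis, the axial velocity points towards `z = 0` at the heights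
that carry vorticity). [cite: LucardoOlivaes2026, §3 p.2 l.12–18] -/
def IsOuroGeometry (v : E3 → E3) : Prop :=
  (∀ x, v (mirrorZ x) = mirrorZ (v x)) ∧
  (∀ x, ⟪v x, WithLp.toLp 2 ![-x 1, x 0, 0]⟫_ℝ = 0) ∧
  (∀ x, x 2 = 0 → curl v x = 0) ∧
  (∀ x, curl v x ≠ 0 → x 2 * (v (WithLp.toLp 2 ![0, 0, x 2])) 2 < 0)

/-- **The printed ALIGNMENT clause** (§3 p.2 l.16–18 «the stretching matrix S = ½(∇u+(∇u)ᵀ) maintains a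
dominant positive eigenvalue λ(t) aligned with the vorticity vector ω», read at `t = 0`; §4.1 l.47–48 «the
stretching rate λ(t) becomes inherently proportional to the maximum local vorticity accumulation»):
wherever the vorticity is non-zero, `ω·(ω·∇)v = ω·Sω > 0` (referee's scratch 1d6cbf4ca51518ef, SEPARATE
predicate by the chair's ruling). [cite: LucardoOlivaes2026, §3 p.2 l.16–18; §4.1 p.2 l.47–48] -/
def IsAlignedDatum (v : E3 → E3) : Prop :=
  ∀ x, curl v x ≠ 0 → 0 < ⟪curl v x, fderiv ℝ v x (curl v x)⟫_ℝ

/-- **(6) at the solution grain ON THE PRINTED GEOMETRY** (chair's decl of record for the token): as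
`Step6_StretchLower`, the datum restricted to `IsOuroDatum ∧ IsOuroGeometry ∧ IsAlignedDatum`.
[cite: LucardoOlivaes2026, (6) §4.1 p.2 l.44–54 with §3 p.2 l.12–26] -/
def Step6G_StretchLower : Prop :=
  ∀ ν : ℝ, 0 < ν → ∀ v₀ : E3 → E3, IsOuroDatum v₀ → IsOuroGeometry v₀ → IsAlignedDatum v₀ →
    ∃ C₁ : ℝ, 0 < C₁ ∧ ∀ (T : ℝ) (u : ℝ → E3 → E3) (p : ℝ → E3 → ℝ), IsLocalSolution ν T v₀ u p →
      ∀ t ∈ Ico 0 T, C₁ * supVort u t * ensq u t ≤ stretchI (u t)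

/-- **(6) at `t = 0` ON THE PRINTED GEOMETRY** (referee's R#3 / R#3′ with the alignment clause): the per-datum
face over `IsOuroDatum ∧ IsOuroGeometry ∧ IsAlignedDatum` — a THEOREM (`step6G_perDatum_holds`).
[cite: LucardoOlivaes2026, (6) §4.1 p.2 l.44–54 with §3 p.2 l.12–26] -/
def Step6G_perDatum : Prop :=
  ∀ v : E3 → E3, IsOuroDatum v → IsOuroGeometry v → IsAlignedDatum v →
    ∃ C₁ : ℝ, 0 < C₁ ∧ C₁ * (⨆ x, ‖curl v x‖) * (∫ x, ‖curl v x‖ ^ 2) ≤ stretchI v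

/-- **§3 at the printed geometric grain** (p.2 l.12–26): a datum of the analytic class WITH the printed
geometry and alignment exists (the construction the section describes in prose; no formula printed).
[cite: LucardoOlivaes2026, §3 p.2 l.12–26] -/
def Step3G_Datum : Prop :=
  ∃ v₀ : E3 → E3, IsOuroDatum v₀ ∧ IsOuroGeometry v₀ ∧ IsAlignedDatum v₀

/-- (6) over the analytic class implies (6) over the printed geometry (restriction; pure logic).
[cite: LucardoOlivaes2026, (6) p.2 l.44–54] -/
theorem step6G_of_step6 (h : Step6_StretchLower) : Step6G_StretchLower :=
  fun ν hν v₀ hD _ _ => h ν hν v₀ hD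

/-- **COMPOSITION through the printed geometry (PROVED)**: §3 at the geometric grain, (5), (6) on the
geometry, §5, the reduction and the divergence sentence ⇒ the claim (`ClaimedTheorem`'s datum class
`IsOuroDatum` is the wider analytic class; the geometric datum witnesses it — nothing forced).
[cite: LucardoOlivaes2026, §§3–6 pp.2–3] -/
theorem claim_of_stepsG (h3 : Step3G_Datum) (h5 : Step5_EnstrophyId) (h6 : Step6G_StretchLower)
    (h7 : Step7_DissipRate) (h9 : Step9_Reduction8) (h10 : Step10_Divergence) : ClaimedTheorem := by
  intro ν hν
  obtain ⟨v₀, hD, hG, hA⟩ := h3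
  obtain ⟨C₁, hC₁, H6⟩ := h6 ν hν v₀ hD hG hA
  -- (5) ∧ (6)|geometry ⇒ (7) with coefficient `2ν` for THIS datum (as in `diffIneq7_of_steps`)
  have h7' : DiffIneq7 ν (2 * ν) v₀ := by
    refine ⟨2 * C₁, by positivity, fun T u p hsol t ht => ?_⟩
    have hd := h5 ν hν T v₀ u p hsol t ht
    have hd2 : HasDerivAt (ensq u) (2 * (stretchI (u t) - ν * vortgradsq u t)) t := by
      have h := hd.const_mul (2 : ℝ)
      simp only [← mul_assoc] at h
      norm_num at h
      exact h
    refine ⟨_, hd2, ?_⟩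
    have h6t := H6 T u p hsol t ⟨ht.1.le, ht.2⟩
    linarith
  have h8 : ODE8 ν v₀ := h9 ν hν v₀ hD (2 * ν) (by positivity) h7' (h7 ν hν v₀ hD)
  exact ⟨v₀, hD, h10 ν hν v₀ hD h8⟩

/-! #### The `t = 0` slice of (6) on the printed geometry is a theorem; the sign flip leaves the geometry -/

/-- The stretching integrand `x ↦ ⟪curl v x, Dv(x)(curl v x)⟫` is continuous for `v ∈ C^∞` (proof device,
after the referee's scratch 1d6cbf4ca51518ef). [folklore] -/
private theorem continuous_stretchIntegrand {v : E3 → E3} (hv : ContDiff ℝ ∞ v) :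
    Continuous fun x => ⟪curl v x, fderiv ℝ v x (curl v x)⟫_ℝ := by
  have hc : Continuous (curl v) := continuous_curl (hv.of_le (by norm_cast))
  have hD : Continuous (fderiv ℝ v) := hv.continuous_fderiv (by norm_num)
  exact hc.inner (hD.clm_apply hc)

/-- **On an aligned Ouroboros datum the stretching integral is POSITIVE**: the integrand is `≥ 0` everywhere
(`= 0` where `ω = 0`, `> 0` where `ω ≠ 0`), continuous, compactly supported, and positive on the non-empty
open set `{ω ≠ 0}` (re-proof of the referee's `stretchI_pos_of_aligned`, scratch 1d6cbf4ca51518ef).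
[cite: LucardoOlivaes2026, §3 p.2 l.16–18 with (6) p.2 l.44–54] -/
theorem stretchI_pos_of_aligned {v : E3 → E3} (hD : IsOuroDatum v) (hA : IsAlignedDatum v) :
    0 < stretchI v := by
  obtain ⟨⟨hsm, -, -⟩, hcs, hne⟩ := hD
  set g : E3 → ℝ := fun x => ⟪curl v x, fderiv ℝ v x (curl v x)⟫_ℝ with hg
  have hgc : Continuous g := continuous_stretchIntegrand hsm
  have hg0 : ∀ x, 0 ≤ g x := by
    intro x
    by_cases hx : curl v x = 0
    · simp [hg, hx]
    · exact (hA x hx).le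
  have hgs : HasCompactSupport g := by
    refine hcs.mono ?_
    intro x hx
    rw [mem_support] at hx ⊢
    contrapose! hx
    simp [hg, hx]
  have hgi : Integrable g := hgc.integrable_of_hasCompactSupport hgs
  -- a vortical point
  obtain ⟨x₀, hx₀⟩ : ∃ x, curl v x ≠ 0 := Function.ne_iff.mp hne
  have hpos : 0 < g x₀ := hA x₀ hx₀
  -- the integral of a continuous nonnegative integrable function positive somewhere is positive
  have hsupp : x₀ ∈ support g := by rw [mem_support]; exact hpos.ne'
  have hopen : IsOpen (support g) := hgc.isOpen_support
  have hμ : 0 < volume (support g) := hopen.measure_pos volume ⟨x₀, hsupp⟩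
  unfold stretchI
  exact (integral_pos_iff_support_of_nonneg hg0 hgi).2 hμ

/-- **(6) at `t = 0` holds on every aligned Ouroboros datum** with a per-datum constant (re-proof of the
referee's `step6_t0_of_aligned`): take `C₁ = stretchI v / (2·S)` if `S = (⨆‖curl v‖)·∫‖curl v‖² > 0`, else
`C₁ = 1`. [cite: LucardoOlivaes2026, (6) p.2 l.44–54 with §3 p.2 l.16–18] -/
theorem step6_t0_of_aligned {v : E3 → E3} (hD : IsOuroDatum v) (hA : IsAlignedDatum v) :
    ∃ C₁ : ℝ, 0 < C₁ ∧ C₁ * (⨆ x, ‖curl v x‖) * (∫ x, ‖curl v x‖ ^ 2) ≤ stretchI v := by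
  have hpos := stretchI_pos_of_aligned hD hA
  set S : ℝ := (⨆ x, ‖curl v x‖) * (∫ x, ‖curl v x‖ ^ 2) with hS
  have hS0 : 0 ≤ S :=
    mul_nonneg (Real.iSup_nonneg fun x => norm_nonneg _) (integral_nonneg fun x => by positivity)
  rcases hS0.eq_or_lt with hS00 | hSpos
  · refine ⟨1, one_pos, ?_⟩
    rw [mul_assoc, ← hS, ← hS00]
    simpa using hpos.le
  · refine ⟨stretchI v / (2 * S), by positivity, ?_⟩
    rw [mul_assoc, ← hS, div_mul_comm, mul_comm]
    have : S / (2 * S) = 1 / 2 := by field_simp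
    rw [this]
    linarith

/-- **`Step6G_perDatum` holds**: on the printed class (analytic ∧ geometry ∧ alignment) the `t = 0` slice of
(6) is a consequence of the printed alignment hypothesis — what (6) asserts BEYOND it is the persistence of
one constant `C₁` for all `t ∈ [0,T)` («maintains», p.2 l.17), underived in print.
[cite: LucardoOlivaes2026, (6) p.2 l.44–54 with §3 p.2 l.12–26] -/
theorem step6G_perDatum_holds : Step6G_perDatum :=
  fun _ hD _ hA => step6_t0_of_aligned hD hA

/-- **The sign flip leaves the printed geometry**: if `v` has the geometry and carries vorticity, `−v` does
NOT (the «approaching» clause (iv) reverses: the mirror pair then SEPARATES) — so the sign-trick witnesses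
against the analytic-class faces (`Step6F_StretchLower_fun`, `Step6F_perDatum`, `Step6_StretchLower` at
`t = 0`) lie outside the printed class (re-proof of the referee's `neg_not_geometry`, scratch 06f1b00e682362b8).
[cite: LucardoOlivaes2026, §3 p.2 l.12–18] -/
theorem neg_not_geometry {v : E3 → E3} (hG : IsOuroGeometry v) (hne : curl v ≠ 0) :
    ¬ IsOuroGeometry (fun x => -v x) := by
  intro hG'
  obtain ⟨x₀, hx₀⟩ : ∃ x, curl v x ≠ 0 := Function.ne_iff.mp hne
  have h1 := hG.2.2.2 x₀ hx₀
  have hx₀' : curl (fun x => -v x) x₀ ≠ 0 := by rw [curl_neg]; exact neg_ne_zero.2 hx₀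
  have h2 := hG'.2.2.2 x₀ hx₀'
  have : (-v (WithLp.toLp 2 ![0, 0, x₀ 2])) 2 = -((v (WithLp.toLp 2 ![0, 0, x₀ 2])) 2) := rfl
  rw [this] at h2
  linarith

/-- The sign flip also destroys the alignment: `⟪curl(−v), D(−v)(curl(−v))⟫ = −⟪curl v, Dv(curl v)⟫`.
[cite: LucardoOlivaes2026, §3 p.2 l.16–18] -/
theorem neg_not_aligned {v : E3 → E3} (hA : IsAlignedDatum v) (hne : curl v ≠ 0) :
    ¬ IsAlignedDatum (fun x => -v x) := by
  intro hA'
  obtain ⟨x₀, hx₀⟩ : ∃ x, curl v x ≠ 0 := Function.ne_iff.mp hne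
  have h1 := hA x₀ hx₀
  have hx₀' : curl (fun x => -v x) x₀ ≠ 0 := by rw [curl_neg]; exact neg_ne_zero.2 hx₀
  have h2 := hA' x₀ hx₀'
  rw [curl_neg, fderiv_fun_neg] at h2
  have hval : ⟪-curl v x₀, (-fderiv ℝ v x₀) (-curl v x₀)⟫_ℝ = -⟪curl v x₀, fderiv ℝ v x₀ (curl v x₀)⟫_ℝ := by
    simp
  rw [hval] at h2
  linarith

/-! #### Discharge of the recorded downstream step (D-0026) -/

/-- **Step 11 holds** (p.3 l.16–19 with (4) at the solution grain): along a regular solution of the BKM class,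
enstrophy divergence at `T` forces `∫₀ᵀ‖ω‖_{L^∞} = ∞` — contrapositive of the tree's Beale–Kato–Majda a priori
`H³` bound `MajdaBertozzi2002_bkmAprioriH3_holds` (Majda–Bertozzi 2002, proof of Thm 3.6) with the pointwise
`|curl v| ≤ ‖curlCLM‖·‖Dv‖`. Downstream of the claimed blow-up; C137's locator untouched.
[cite: LucardoOlivaes2026, p.3 l.16–19; (4) p.2 l.5–11] -/
theorem step11_holds : Step11_BKM := by
  intro ν hν T v₀ u p hsol _hD hdiv
  by_contra hne
  have hlt : (∫⁻ t in Ioo 0 T, ⨆ x, ‖curl (u t) x‖ₑ) < ⊤ := lt_top_iff_ne_top.2 hne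
  obtain ⟨t0, ht0, -⟩ := hdiv 0
  have hT : 0 < T := lt_of_le_of_lt ht0.1 ht0.2
  obtain ⟨A, hA⟩ := MajdaBertozzi2002_bkmAprioriH3_holds hν.le hT hsol.isClassical hsol.sobolev hlt
  set c : ℝ := ‖(curlCLM : (EuclideanSpace ℝ (Fin 3) →L[ℝ] EuclideanSpace ℝ (Fin 3)) →L[ℝ]
      EuclideanSpace ℝ (Fin 3))‖ with hc
  obtain ⟨t, ht, hMt⟩ := hdiv (c ^ 2 * (A : ℝ))
  -- the `H¹` piece of the BKM bound at time `t`
  have h1 : ∫⁻ x, ‖iteratedFDeriv ℝ 1 (u t) x‖ₑ ^ 2 ≤ (A : ℝ≥0∞) := by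
    refine le_trans ?_ (hA t ht)
    exact Finset.single_le_sum (f := fun n => ∫⁻ x, ‖iteratedFDeriv ℝ n (u t) x‖ₑ ^ 2)
      (fun _ _ => bot_le) (by simp)
  have heq : (fun x => ‖iteratedFDeriv ℝ 1 (u t) x‖ₑ ^ 2) = fun x => ‖fderiv ℝ (u t) x‖ₑ ^ 2 := by
    funext x
    rw [← ofReal_norm, norm_iteratedFDeriv_one, ofReal_norm]
  rw [heq] at h1
  have hfin : ∫⁻ x, ‖fderiv ℝ (u t) x‖ₑ ^ 2 < ⊤ := h1.trans_lt ENNReal.coe_lt_top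
  have hsm : ContDiff ℝ ∞ (u t) := hsol.isClassical.contDiff_velocity ht
  have hcontD : Continuous (fderiv ℝ (u t)) := hsm.continuous_fderiv (by norm_num)
  have hintD : Integrable (fun x => ‖fderiv ℝ (u t) x‖ ^ 2) :=
    integrable_sq_norm_of_lintegral_lt_top hcontD hfin
  -- `∫‖Du(t)‖² ≤ A`
  have hD_le : ∫ x, ‖fderiv ℝ (u t) x‖ ^ 2 ≤ (A : ℝ) := by
    have h2 : ENNReal.ofReal (∫ x, ‖fderiv ℝ (u t) x‖ ^ 2) ≤ (A : ℝ≥0∞) := by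
      rw [ofReal_integral_eq_lintegral_ofReal hintD (Eventually.of_forall fun x => sq_nonneg _)]
      refine le_trans (le_of_eq ?_) h1
      refine lintegral_congr fun x => ?_
      rw [← ofReal_norm, ENNReal.ofReal_pow (norm_nonneg _)]
    have := (ENNReal.ofReal_le_iff_le_toReal ENNReal.coe_ne_top).1 h2
    simpa using this
  -- `∫‖curl u(t)‖² ≤ c² ∫‖Du(t)‖²`
  have hle : ∀ x, ‖curl (u t) x‖ ^ 2 ≤ c ^ 2 * ‖fderiv ℝ (u t) x‖ ^ 2 := fun x => by
    rw [← mul_pow]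
    exact pow_le_pow_left₀ (norm_nonneg _) (norm_curl_le (u t) x) 2
  have hens : ensq u t ≤ c ^ 2 * (A : ℝ) := by
    unfold ensq
    calc ∫ x, ‖curl (u t) x‖ ^ 2 ≤ ∫ x, c ^ 2 * ‖fderiv ℝ (u t) x‖ ^ 2 :=
          integral_mono_of_nonneg (Eventually.of_forall fun x => sq_nonneg _) (hintD.const_mul _)
            (Eventually.of_forall hle)
      _ = c ^ 2 * ∫ x, ‖fderiv ℝ (u t) x‖ ^ 2 := integral_const_mul _ _
      _ ≤ c ^ 2 * (A : ℝ) := by gcongr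
  exact absurd hMt (not_lt.2 hens)

/-! ### Rev 4 (ADDITIVE — chair RULED 2026-08-27T08:08:56Z on second refuter refuter-3 g3's rider R2
08:06:38Z; referee ref-1 g4 ACK 08:10:00Z): VACUITY GUARD (TYPING-HYGIENE 13). On AXISYMMETRIC swirl-free
data `⟪ω, Dv ω⟫ = ω_θ² v_r/ρ` (Majda–Bertozzi §2.3 (2.58) p.57), so the POINTWISE alignment clause
`IsAlignedDatum` of rev 3 forces `ω ≡ 0` on `{v_r ≤ 0}` and, by a minimum principle, has NO non-zero
axisymmetric inhabitant on paper (R2) — it would exclude the print's own datum (two coaxial anti-parallel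
rings, §3 p.2 l.12–18) and let `Step6G_StretchLower` hold vacuously. The WEAKEST printed-faithful reading of
l.16–18 that keeps the print's datum inside the class and is EXACTLY what (6) consumes at `t = 0` is the
INTEGRATED one: net positive vortex stretching of the datum, `0 < stretchI v` (`IsAlignedDatumI`). The token
decl of record becomes `Step6GI_StretchLower` (same locator (6) §4.1 p.2 l.44–54, same class call); rev 3's
pointwise face stays ALONGSIDE with rider R2 recorded. Nothing above is touched. -/

/-- **The printed ALIGNMENT clause, integrated reading** (§3 p.2 l.16–18 «the stretching matrix S maintains
a dominant positive eigenvalue λ(t) aligned with the vorticity vector ω», read at `t = 0` as NET positive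
vortex stretching of the datum: `∫ ω·(ω·∇)v = ∫ ω·Sω > 0` — the quantity (6) bounds from below; chair
08:08:56Z, weakest faithful reading keeping the axisymmetric ring datum inside the class).
[cite: LucardoOlivaes2026, §3 p.2 l.16–18; (6) §4.1 p.2 l.44–54] -/
def IsAlignedDatumI (v : E3 → E3) : Prop := 0 < stretchI v

/-- **(6) at the solution grain ON THE PRINTED GEOMETRY with INTEGRATED alignment** — TOKEN DECL OF RECORD
(chair 08:08:56Z; supersedes the NAME `Step6G_StretchLower`, same locator, same class): as
`Step6_StretchLower` / `Step6G_StretchLower`, the datum restricted to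
`IsOuroDatum ∧ IsOuroGeometry ∧ IsAlignedDatumI`. What it asserts beyond its (provable) `t = 0` slice is the
PERSISTENCE of one constant `C₁` along the solution for all `t ∈ [0,T)` («maintains», l.17), underived in print.
[cite: LucardoOlivaes2026, (6) §4.1 p.2 l.44–54 with §3 p.2 l.12–26] -/
def Step6GI_StretchLower : Prop :=
  ∀ ν : ℝ, 0 < ν → ∀ v₀ : E3 → E3, IsOuroDatum v₀ → IsOuroGeometry v₀ → IsAlignedDatumI v₀ →
    ∃ C₁ : ℝ, 0 < C₁ ∧ ∀ (T : ℝ) (u : ℝ → E3 → E3) (p : ℝ → E3 → ℝ), IsLocalSolution ν T v₀ u p →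
      ∀ t ∈ Ico 0 T, C₁ * supVort u t * ensq u t ≤ stretchI (u t)

/-- **(6) at `t = 0` ON THE PRINTED GEOMETRY with integrated alignment**: the per-datum face over
`IsOuroDatum ∧ IsOuroGeometry ∧ IsAlignedDatumI` — a THEOREM (`step6GI_perDatum_holds`).
[cite: LucardoOlivaes2026, (6) §4.1 p.2 l.44–54 with §3 p.2 l.12–26] -/
def Step6GI_perDatum : Prop :=
  ∀ v : E3 → E3, IsOuroDatum v → IsOuroGeometry v → IsAlignedDatumI v →
    ∃ C₁ : ℝ, 0 < C₁ ∧ C₁ * (⨆ x, ‖curl v x‖) * (∫ x, ‖curl v x‖ ^ 2) ≤ stretchI v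

/-- **§3 at the printed geometric grain, integrated alignment** (p.2 l.12–26): a datum of the analytic class
WITH the printed geometry and net positive stretching exists (prose construction, no formula printed; OPEN as
typed, not a theorem — recorded plausible: second refuter refuter-3 g3 08:09:38Z exhibits on paper an
axisymmetric swirl-free mirror-symmetric approaching configuration built from tree parts with
`stretchI > 0` (the D6 configuration with the EXPANSIVE cavity), kernel build not commissioned).
[cite: LucardoOlivaes2026, §3 p.2 l.12–26] -/
def Step3GI_Datum : Prop :=
  ∃ v₀ : E3 → E3, IsOuroDatum v₀ ∧ IsOuroGeometry v₀ ∧ IsAlignedDatumI v₀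

/-! #### Bridges between the pointwise (rev 3) and integrated (rev 4) faces — HYGIENE 8, all pure logic
plus the rev-3 theorem `stretchI_pos_of_aligned` -/

/-- Pointwise alignment on an Ouroboros datum implies integrated alignment (= rev 3's
`stretchI_pos_of_aligned`). [cite: LucardoOlivaes2026, §3 p.2 l.16–18] -/
theorem alignedI_of_aligned {v : E3 → E3} (hD : IsOuroDatum v) (hA : IsAlignedDatum v) :
    IsAlignedDatumI v :=
  stretchI_pos_of_aligned hD hA

/-- The pointwise-class datum sentence implies the integrated-class one. [cite: LucardoOlivaes2026, §3 p.2 l.12–26] -/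
theorem step3GI_of_step3G (h : Step3G_Datum) : Step3GI_Datum := by
  obtain ⟨v₀, hD, hG, hA⟩ := h
  exact ⟨v₀, hD, hG, alignedI_of_aligned hD hA⟩

/-- (6) on the integrated class implies (6) on the pointwise class (the I-class is WIDER).
[cite: LucardoOlivaes2026, (6) p.2 l.44–54] -/
theorem step6G_of_step6GI (h : Step6GI_StretchLower) : Step6G_StretchLower :=
  fun ν hν v₀ hD hG hA => h ν hν v₀ hD hG (alignedI_of_aligned hD hA)

/-- (6) over the analytic class implies (6) over the integrated geometric class (restriction).
[cite: LucardoOlivaes2026, (6) p.2 l.44–54] -/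
theorem step6GI_of_step6 (h : Step6_StretchLower) : Step6GI_StretchLower :=
  fun ν hν v₀ hD _ _ => h ν hν v₀ hD

/-- The per-datum faces: integrated class implies pointwise class. [cite: LucardoOlivaes2026, (6) p.2 l.44–54] -/
theorem step6G_perDatum_of_GI (h : Step6GI_perDatum) : Step6G_perDatum :=
  fun v hD hG hA => h v hD hG (alignedI_of_aligned hD hA)

/-- **COMPOSITION through the printed geometry with integrated alignment (PROVED)**: §3 at the I-grain, (5),
(6) on the I-class, §5, the reduction and the divergence sentence ⇒ the claim (the I-datum witnesses
`ClaimedTheorem`'s wider analytic class; nothing forced). [cite: LucardoOlivaes2026, §§3–6 pp.2–3] -/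
theorem claim_of_stepsGI (h3 : Step3GI_Datum) (h5 : Step5_EnstrophyId) (h6 : Step6GI_StretchLower)
    (h7 : Step7_DissipRate) (h9 : Step9_Reduction8) (h10 : Step10_Divergence) : ClaimedTheorem := by
  intro ν hν
  obtain ⟨v₀, hD, hG, hA⟩ := h3
  obtain ⟨C₁, hC₁, H6⟩ := h6 ν hν v₀ hD hG hA
  -- (5) ∧ (6)|I-geometry ⇒ (7) with coefficient `2ν` for THIS datum (as in `diffIneq7_of_steps`)
  have h7' : DiffIneq7 ν (2 * ν) v₀ := by
    refine ⟨2 * C₁, by positivity, fun T u p hsol t ht => ?_⟩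
    have hd := h5 ν hν T v₀ u p hsol t ht
    have hd2 : HasDerivAt (ensq u) (2 * (stretchI (u t) - ν * vortgradsq u t)) t := by
      have h := hd.const_mul (2 : ℝ)
      simp only [← mul_assoc] at h
      norm_num at h
      exact h
    refine ⟨_, hd2, ?_⟩
    have h6t := H6 T u p hsol t ⟨ht.1.le, ht.2⟩
    linarith
  have h8 : ODE8 ν v₀ := h9 ν hν v₀ hD (2 * ν) (by positivity) h7' (h7 ν hν v₀ hD)
  exact ⟨v₀, hD, h10 ν hν v₀ hD h8⟩

/-! #### The `t = 0` slice of (6) on the integrated class is a theorem; the sign flip leaves the I-class -/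

/-- **(6) at `t = 0` from net positive stretching alone**, per-datum constant `C₁ = stretchI v / (2·S)` if
`S = (⨆‖curl v‖)·∫‖curl v‖² > 0`, else `C₁ = 1` (the rev-3 route with the hypothesis weakened to what it
used; = referee ref-1 g4's `step6G_of_pos`, scratch 06f1b00e682362b8).
[cite: LucardoOlivaes2026, (6) p.2 l.44–54 with §3 p.2 l.16–18] -/
theorem step6_t0_of_alignedI {v : E3 → E3} (hI : IsAlignedDatumI v) :
    ∃ C₁ : ℝ, 0 < C₁ ∧ C₁ * (⨆ x, ‖curl v x‖) * (∫ x, ‖curl v x‖ ^ 2) ≤ stretchI v := by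
  have hpos : 0 < stretchI v := hI
  set S : ℝ := (⨆ x, ‖curl v x‖) * (∫ x, ‖curl v x‖ ^ 2) with hS
  have hS0 : 0 ≤ S :=
    mul_nonneg (Real.iSup_nonneg fun x => norm_nonneg _) (integral_nonneg fun x => by positivity)
  rcases hS0.eq_or_lt with hS00 | hSpos
  · refine ⟨1, one_pos, ?_⟩
    rw [mul_assoc, ← hS, ← hS00]
    simpa using hpos.le
  · refine ⟨stretchI v / (2 * S), by positivity, ?_⟩
    rw [mul_assoc, ← hS, div_mul_comm, mul_comm]
    have : S / (2 * S) = 1 / 2 := by field_simp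
    rw [this]
    linarith

/-- **`Step6GI_perDatum` holds**: on the printed class with integrated alignment the `t = 0` slice of (6) is
immediate from the hypothesis `0 < stretchI v` — what the token `Step6GI_StretchLower` asserts BEYOND it is
the persistence of one `C₁` along the solution for `t ∈ [0,T)` («maintains», l.17), underived in print.
[cite: LucardoOlivaes2026, (6) p.2 l.44–54 with §3 p.2 l.12–26] -/
theorem step6GI_perDatum_holds : Step6GI_perDatum :=
  fun _ _ _ hI => step6_t0_of_alignedI hI

/-- The stretching integral is ODD under the sign flip: `stretchI (−v) = −stretchI v` (the integrand picks up
`(−1)³`). [cite: LucardoOlivaes2026, (6) p.2 l.44–54] -/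
theorem stretchI_neg (v : E3 → E3) : stretchI (fun x => -v x) = -stretchI v := by
  unfold stretchI
  rw [← integral_neg]
  refine integral_congr_ae (Eventually.of_forall fun x => ?_)
  simp only [curl_neg, fderiv_fun_neg]
  simp

/-- **The sign flip leaves the integrated class too**: `0 < stretchI v` ⇒ `¬ 0 < stretchI (−v)` — with
`neg_not_geometry` (clause (iv) reverses), the sign-trick witnesses against the analytic-class faces lie
outside `IsOuroDatum ∧ IsOuroGeometry ∧ IsAlignedDatumI` on both counts.
[cite: LucardoOlivaes2026, §3 p.2 l.16–18] -/
theorem neg_not_alignedI {v : E3 → E3} (hI : IsAlignedDatumI v) : ¬ IsAlignedDatumI (fun x => -v x) := by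
  unfold IsAlignedDatumI at hI ⊢
  rw [stretchI_neg]
  linarith

/-! ### D-0026 discharge (post-adjudication debt pass, APPEND-ONLY; rev 1–4 untouched): Step 4 -/

/-- **Step 4 holds** — the vorticity equation (3) p.2 l.1–4 along every regular local solution, one-sided time
derivative within `[0,T)`: the tree's `IsClassicalNSSolutionOn.vorticity_eq` (Majda–Bertozzi 2002, §1.6
Prop. 1.12 / eq. (1.33), §2.4 (2.110)) on the time set `Ico 0 T` (unique differentiability `uniqueDiffOn_Ico`,
`Ico 0 T ⊆ closure (interior (Ico 0 T))`), force `0`; `vorticity u t = curl (u t)` and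
`convect (curl (u t)) (u t) x = D(u t)(x)(curl (u t) x)` definitionally. Upstream of the locator; recorded step,
not consumed by the compositions. [cite: LucardoOlivaes2026, (3) p.2 l.1–4] -/
theorem step4_holds : Step4_VorticityEq := by
  intro ν _ T v₀ u p hsol t ht x
  have hT : 0 < T := ht.1.trans_lt ht.2
  have hcl : Ico (0 : ℝ) T ⊆ closure (interior (Ico (0 : ℝ) T)) := by
    rw [interior_Ico, closure_Ioo hT.ne]; exact Ico_subset_Icc_self
  have h := hsol.isClassical.vorticity_eq (uniqueDiffOn_Ico 0 T) hcl (fun _ _ y => curl_zero y) ht x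
  have hv : vorticity u = fun s y => curl (u s) y := rfl
  rw [hv] at h
  exact h

/-! ### D-0026 discharge (post-adjudication debt pass, APPEND-ONLY): Step 10 — the divergence sentence §6 p.3 l.12–15
at the solution grain is classical: maximal BKM-class solution + ODE comparison + `H¹`/enstrophy continuation. -/

/-- In the class, `∫⁻‖curl (u t)‖ₑ²` is finite and equals `ofReal (ensq u t)` on a slab carrying an
`H¹` bound. [folklore] -/
private theorem lintegral_curl_sq_eq_ofReal_ensq {u : ℝ → E3 → E3} {t : ℝ} (hsm : ContDiff ℝ ∞ (u t))
    (h1 : ∫⁻ x, ‖iteratedFDeriv ℝ 1 (u t) x‖ₑ ^ 2 < ⊤) :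
    ∫⁻ x, ‖curl (u t) x‖ₑ ^ 2 = ENNReal.ofReal (ensq u t) := by
  have hint : Integrable (fun x => ‖curl (u t) x‖ ^ 2) :=
    (integrable_norm_curl_sq (hsm.of_le (by norm_cast)) h1).1
  unfold ensq
  rw [ofReal_integral_eq_lintegral_ofReal hint (ae_of_all _ fun x => sq_nonneg _)]
  refine lintegral_congr fun x => ?_
  rw [← ofReal_norm, ENNReal.ofReal_pow (norm_nonneg _)]

/-- In the class, the enstrophy `t ↦ ∫‖curl u(t)‖²` is continuous on closed slabs (Majda–Bertozzi 2002 Thm. 3.5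
via the tree's `continuousOn_toReal_eLpNorm_curl`). [folklore] -/
private theorem continuousOn_ensq {ν a b : ℝ} {u : ℝ → E3 → E3} {p : ℝ → E3 → ℝ}
    (hS : IsClassicalNSSolutionOn (Icc a b) ν 0 u p) (hB : HasBoundedSobolevNormsOn (Icc a b) u)
    (hab : a < b) : ContinuousOn (ensq u) (Icc a b) := by
  have h := (hS.continuousOn_toReal_eLpNorm_curl hB hab (n := 2) le_rfl).pow 2
  refine h.congr fun t ht => ?_
  have hsm : ContDiff ℝ ∞ (u t) := hS.contDiff_velocity ht
  obtain ⟨C₁, hC₁⟩ := hB 1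
  have h1 : ∫⁻ x, ‖iteratedFDeriv ℝ 1 (u t) x‖ₑ ^ 2 < ⊤ := (hC₁ t ht).trans_lt ENNReal.coe_lt_top
  have hp : ((2 : ℕ) : ℝ≥0∞) = 2 := by norm_num
  simp only [Pi.pow_apply, hp]
  rw [eLpNorm_eq_lintegral_rpow_enorm_toReal two_ne_zero ENNReal.ofNat_ne_top, ENNReal.toReal_ofNat,
    ← ENNReal.toReal_rpow, ← Real.rpow_natCast _ 2, ← Real.rpow_mul ENNReal.toReal_nonneg]
  norm_num
  rw [lintegral_curl_sq_eq_ofReal_ensq hsm h1, ENNReal.toReal_ofReal]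
  exact integral_nonneg fun x => sq_nonneg _

/-- **Step 10 holds** — §6 p.3 l.12–15 at the solution grain: if every regular solution from `v₀` living past
`t₁` obeys (8) (`Y(t₁) > 0`, `Y' ≥ K Y^q`, `q > 1`), then there IS a finite horizon `T* > 0` and a regular
solution from `v₀` on `[0,T*)` whose enstrophy is unbounded. Classical content assembled from the tree: the
BKM-class maximal-solution dichotomy `exists_global_bkmClass_or_blowup` (Majda–Bertozzi Thm. 3.4 / Cor. 3.2 /
Thm. 3.6; Kato), the ODE comparison `step10A_holds` (a global solution would carry `Y` past the comparison
horizon — excluded), and the `H¹`/enstrophy continuation principle `hasSobolevExtensionPast_of_uniform_H1_bound`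
with the energy bound `bkm_energy_le` and the whole-space `div`–`curl` estimate (bounded enstrophy on `[0,T*)`
would continue the maximal solution — excluded). [cite: LucardoOlivaes2026, §6 p.3 l.12–15] -/
theorem step10_holds : Step10_Divergence := by
  intro ν hν v₀ hD h8
  obtain ⟨K, hK, q, hq, t₁, ht₁, H8⟩ := h8
  obtain ⟨hsm₀, hdiv₀, hH₀⟩ := hD.1
  rcases exists_global_bkmClass_or_blowup hν.le hsm₀ hdiv₀ hH₀ with
    ⟨u, p, hu, hu0, hB, -⟩ | ⟨Ts, hTs, u, p, hu, hu0, hreg, -, hnext, -, -⟩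
  · -- ### a GLOBAL regular solution contradicts (8) through the ODE comparison
    exfalso
    -- local solutions of every horizon by restriction
    have hloc : ∀ T : ℝ, 0 < T → IsLocalSolution ν T v₀ u p := fun T _ =>
      ⟨hu.mono Ico_subset_Ici_self (uniqueDiffOn_Ico 0 T), hu0, fun T'' _ => hB T''⟩
    -- the enstrophy is continuous on `[t₁, ∞)` and positive at `t₁`
    set s₀ : ℝ := t₁ + 1 with hs₀
    have hcont : ∀ b : ℝ, t₁ < b → ContinuousOn (ensq u) (Icc t₁ b) := fun b hb =>
      continuousOn_ensq (hu.mono (fun t ht => (ht₁.trans ht.1 : (0:ℝ) ≤ t)) (uniqueDiffOn_Icc hb))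
        ((hB b).mono (Icc_subset_Icc_left ht₁)) hb
    -- (8) on the horizon `T := s + Y(s)^{1-q}/((q-1)K) + 1` for a suitable start `s`
    -- choose the start: `t₁` itself (continuity on `[t₁, T)` is available)
    set Y₁ : ℝ := ensq u t₁ with hY₁
    set T : ℝ := t₁ + Y₁ ^ (1 - q) / ((q - 1) * K) + 1 with hT
    have hY₁0 : 0 ≤ Y₁ := integral_nonneg fun x => sq_nonneg _
    have hT₁ : t₁ < T := by
      have : 0 ≤ Y₁ ^ (1 - q) / ((q - 1) * K) :=
        div_nonneg (Real.rpow_nonneg hY₁0 _) (mul_nonneg (by linarith) hK.le)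
      linarith
    have hTpos : 0 < T := lt_of_le_of_lt ht₁ hT₁
    obtain ⟨hpos, hode⟩ := H8 T u p (hloc T hTpos) hT₁
    have hc : ContinuousOn (ensq u) (Ico t₁ T) := (hcont T hT₁).mono Ico_subset_Icc_self
    have hle := step10A_holds K q t₁ T (ensq u) hK hq hT₁ hc hpos hode
    rw [hT] at hle
    linarith
  · -- ### the MAXIMAL solution on `[0,T*)`: bounded enstrophy would continue it past `T*`
    refine ⟨Ts, hTs, u, p, ⟨hu, hu0, hreg⟩, ?_⟩
    by_contra hbdd
    unfold EnstrophyDiverges at hbdd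
    push Not at hbdd
    obtain ⟨M, hM⟩ := hbdd
    apply hnext
    -- energy at the datum
    set E₀ : ℝ := ∫ x, ‖v₀ x‖ ^ 2 with hE₀
    have hE₀0 : 0 ≤ E₀ := integral_nonneg fun x => sq_nonneg _
    have hM0 : 0 ≤ max M 0 := le_max_right _ _
    refine hasSobolevExtensionPast_of_uniform_H1_bound hν hTs hu hreg (add_nonneg hE₀0 hM0)
      (A := E₀ + max M 0) fun t ht => ?_
    have hct : ContDiff ℝ ∞ (u t) := hu.contDiff_velocity ht
    -- the closed sub-slab `[0, t'']`, `t'' = (t + T*)/2`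
    have ht'' : (t + Ts) / 2 < Ts := by linarith [ht.2]
    have htt'' : t ≤ (t + Ts) / 2 := by linarith [ht.2]
    obtain ⟨C₀, hC₀⟩ := hreg _ ht'' 0
    obtain ⟨C₁, hC₁⟩ := hreg _ ht'' 1
    have hL2 : ∫⁻ x, ‖u t x‖ₑ ^ 2 < ⊤ := by
      rw [lintegral_enorm_sq_eq_lintegral_iteratedFDeriv_zero]
      exact (hC₀ t ⟨ht.1, htt''⟩).trans_lt ENNReal.coe_lt_top
    have h1 : ∫⁻ x, ‖iteratedFDeriv ℝ 1 (u t) x‖ₑ ^ 2 < ⊤ := (hC₁ t ⟨ht.1, htt''⟩).trans_lt ENNReal.coe_lt_top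
    -- energy inequality `∫‖u t‖² ≤ E₀`
    have hEt : ∫ x, ‖u t x‖ ^ 2 ≤ E₀ := by
      rcases eq_or_lt_of_le ht.1 with h0 | htpos
      · rw [← h0, hu0]
      · have hcl : IsClassicalNSSolutionOn (Icc 0 t) ν 0 u p :=
          hu.mono (fun s hs => ⟨hs.1, lt_of_le_of_lt hs.2 ht.2⟩) (uniqueDiffOn_Icc htpos)
        have := hcl.bkm_energy_le hν.le htpos (hreg t ht.2) (right_mem_Icc.2 ht.1)
        rwa [hu0] at this
    have hEt' : ∫⁻ x, ‖u t x‖ₑ ^ 2 ≤ ENNReal.ofReal E₀ := by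
      have hconv : ∫⁻ x, ‖u t x‖ₑ ^ 2 = ENNReal.ofReal (∫ x, ‖u t x‖ ^ 2) := by
        rw [integral_sq_norm_eq_toReal hct.continuous, ENNReal.ofReal_toReal hL2.ne]
      rw [hconv]
      exact ENNReal.ofReal_le_ofReal hEt
    -- gradient by enstrophy (div–curl) `∫|Du(t)|²_F ≤ ∫|curl u(t)|² ≤ max M 0`
    have hgrad : ∫⁻ x, ENNReal.ofReal (frobeniusNormSq (fderiv ℝ (u t) x)) ≤ ENNReal.ofReal (max M 0) := by
      refine (lintegral_frobeniusNormSq_fderiv_le_lintegral_sq_norm_curl (hct.of_le (by norm_cast))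
        (hu.divFree t ht) hL2).trans ?_
      rw [lintegral_curl_sq_eq_ofReal_ensq hct h1]
      exact ENNReal.ofReal_le_ofReal ((hM t ht).trans (le_max_left _ _))
    calc (∫⁻ x, ‖u t x‖ₑ ^ 2) + (∫⁻ x, ENNReal.ofReal (frobeniusNormSq (fderiv ℝ (u t) x)))
        ≤ ENNReal.ofReal E₀ + ENNReal.ofReal (max M 0) := add_le_add hEt' hgrad
      _ = ENNReal.ofReal (E₀ + max M 0) := (ENNReal.ofReal_add hE₀0 hM0).symm

end Literature.Claims.NS.LucardoOlivaes2026

end
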